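import Mathlib
import Summits.MatrixMultiplication.MatrixMultiplication.Theorems.AutomaticSTPPDesignsAutomaticDesignBelowFourFifthsStubSlicedSTPPKernel

/-!
# The digit-sum-sliced laser family is an STPP family of ONE cyclic group `ℤ/ℓ^N`

Route `MatrixMultiplication/AutomaticSTPPDesigns`, crux `stmt-MatrixMultiplication-7357`
(`AutomaticDesignBelowFourFifths`), line `digit-sum-sliced-laser`, stub `stub_slicedSTPP` (the
load-bearing stub of the line).

Coppersmith–Winograd's level-1 laser design for `CW_q` read inside the carry-free truncated
convolution `T_ℓ^lower`, `ℓ = q + 2` (digits `0 ↦` level `0`, `1 … q ↦` level `1`, `q+1 ↦` level `2`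
for the first two tensor legs, reversed for the third), restricted to a typed free diagonal `Δ` of
level triples `(I, J, K)` (pointwise weight `2`, pattern classes `P₁ = (0,1,1)`, `P₂ = (1,0,1)`,
`P₃ = (1,1,0)` of size `a`, types `(a+2b, 2a, b)`, FREE), with every free digit class SLICED to one
digit sum `σ`, is an honest simultaneous-triple-product-property family (CKSU 2005 Def. 5.1, the
tree's `IsSTPP`) in the cyclic group `ℤ/ℓ^N` — provided additions of digit vectors with conserved
digit sum are digitwise (Kummer's carry identity, the hypothesis `hdig` = stub `stub_digitwise`).

Witnesses (B and C NEGATED): for the `i`-th triple `(I, J, K)` of `Δ` and `κ, μ, ν ∈ Sl`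
(`Sl ⊆ (Fin a → Fin q)` a slice of constant coordinate sum, grafted onto the classes along
`Finset.orderEmbOfFin`),
`A_i = {[(q+1)·1_{I=2} + (κ+1) on P₂]}`, `B_i = {-[(μ+1) on P₃]}`,
`C_i = {-[(q+1)·1_{J=2 ∨ (I,J)=(1,1)} + (ν+1) on P₁]}`.
Then `A_i - B_i`, `B_j - C_j`, `A_k - C_k` are values of digit vectors `x, y, z ∈ [0, ℓ)^N` with
level sequences `I_i, J_j, K_k` and constant digit sums; the STPP relation is `[x] + [y] = [z]`,
hence digitwise; per coordinate the level weight is `≥ 2`, the total is `2N` by the types, so it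
is `2` everywhere, freeness gives `i = j = k`, and the shared digits agree (the abstract argument is
`slicedSTPP_kernel`, file `…StubSlicedSTPPKernel.lean`; this file supplies the enumeration of `Δ`,
the classes, the explicit vectors and their value tables).
-/

-- single-conjunct summit: the mandated namespace repeats `MatrixMultiplication`.
set_option linter.dupNamespace false

noncomputable section

open Finset
open scoped BigOperators

namespace Summit.MatrixMultiplication.MatrixMultiplication.Theorems

namespace AutomaticDesignBelowFourFifths

open Literature.Computability.AlgebraicComplexity (IsSTPP letterCount letterCount_apply sum_letterCount)
open Literature.Computability.AutomaticStructures (digitValue natCast_digitValue_injective)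

/-! ## The registered stub -/

/-- **The sliced level-1 laser family is an STPP family of one cyclic group** (stub
`stub_slicedSTPP` of line `digit-sum-sliced-laser`; Coppersmith–Winograd 1990 §7 / BCS 1997
Thm. 15.41 blocks read in `T_ℓ^lower`, `ℓ = q + 2`; CKSU 2005 Def. 5.1 in the tree's `IsSTPP`
orientation `(s'-t) + (t'-u) = (s-u')`).  Data: a set `Δ` of level triples over `Fin N`, pointwise of
weight `2`, with `a` positions of each pattern `(1,1,·), (0,1,·), (1,0,·)`, typed `(a+2b, 2a, b)` in
all three components and FREE; a slice `Sl ⊆ (Fin a → Fin q)` of constant coordinate sum `σ`; the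
digitwise property of `(ℓ, N)` (Kummer).  Conclusion: an `IsSTPP` family
`A B C : Fin |Δ| → Finset (ZMod (ℓ^N))` with `|A_i| = |B_i| = |C_i| = |Sl|`.  Witnesses:
`A_i = {[(q+1)·1_{I=2} + (κ+1) on P₂]}`, `B_i = {-[(μ+1) on P₃]}`,
`C_i = {-[(q+1)·1_{J=2 ∨ (I,J)=(1,1)} + (ν+1) on P₁]}` (`κ μ ν ∈ Sl` grafted onto the classes
`P₁ = {I=0,J=1}`, `P₂ = {I=1,J=0}`, `P₃ = {I=1,J=1}` along `Finset.orderEmbOfFin`); verification by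
`slicedSTPP_kernel`. [cite: CohnKleinbergSzegedyUmans2005, Def. 5.1] -/
theorem stub_slicedSTPP :
    ∀ (q ℓ N a b : ℕ), 1 ≤ q → q + 2 = ℓ →
      (∀ x y z : Fin N → Fin ℓ,
        (digitValue x : ZMod (ℓ ^ N)) + (digitValue y : ZMod (ℓ ^ N)) =
            (digitValue z : ZMod (ℓ ^ N)) →
        (∑ t, (x t : ℕ)) + (∑ t, (y t : ℕ)) = ∑ t, (z t : ℕ) → ∀ t, (x t : ℕ) + y t = z t) →
      ∀ Δ : Finset ((Fin N → Fin 3) × (Fin N → Fin 3) × (Fin N → Fin 3)),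
        (∀ δ ∈ Δ, ∀ t, (δ.1 t : ℕ) + δ.2.1 t + δ.2.2 t = 2) →
        (∀ δ ∈ Δ, (univ.filter fun t => δ.1 t = 1 ∧ δ.2.1 t = 1).card = a ∧
          (univ.filter fun t => δ.1 t = 0 ∧ δ.2.1 t = 1).card = a ∧
          (univ.filter fun t => δ.1 t = 1 ∧ δ.2.1 t = 0).card = a) →
        (∀ δ ∈ Δ,
          (letterCount δ.1 0 = a + 2 * b ∧ letterCount δ.1 1 = 2 * a ∧ letterCount δ.1 2 = b) ∧
          (letterCount δ.2.1 0 = a + 2 * b ∧ letterCount δ.2.1 1 = 2 * a ∧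
            letterCount δ.2.1 2 = b) ∧
          (letterCount δ.2.2 0 = a + 2 * b ∧ letterCount δ.2.2 1 = 2 * a ∧
            letterCount δ.2.2 2 = b)) →
        (∀ δ ∈ Δ, ∀ δ' ∈ Δ, ∀ δ'' ∈ Δ,
          (∀ t, (δ.1 t : ℕ) + δ'.2.1 t + δ''.2.2 t = 2) → δ = δ' ∧ δ' = δ'') →
        ∀ (Sl : Finset (Fin a → Fin q)) (σ : ℕ), (∀ κ ∈ Sl, ∑ t, (κ t : ℕ) = σ) →
          ∃ A B C : Fin Δ.card → Finset (ZMod (ℓ ^ N)),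
            IsSTPP A B C ∧
              ∀ i, (A i).card = Sl.card ∧ (B i).card = Sl.card ∧ (C i).card = Sl.card := by
  classical
  intro q ℓ N a b _hq hℓ hdig Δ hwt hpat htyp hfree Sl σ hSl
  /- 1. enumerate `Δ` and transport the hypotheses to block indices `i : Fin |Δ|` -/
  obtain ⟨e⟩ : Nonempty (Fin Δ.card ≃ {δ // δ ∈ Δ}) :=
    ⟨(Fintype.equivFinOfCardEq (Fintype.card_coe Δ)).symm⟩
  obtain ⟨I, hI⟩ : ∃ I : Fin Δ.card → Fin N → Fin 3, ∀ i, I i = (e i).1.1 := ⟨_, fun _ => rfl⟩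
  obtain ⟨J, hJ⟩ : ∃ J : Fin Δ.card → Fin N → Fin 3, ∀ i, J i = (e i).1.2.1 := ⟨_, fun _ => rfl⟩
  obtain ⟨K, hK⟩ : ∃ K : Fin Δ.card → Fin N → Fin 3, ∀ i, K i = (e i).1.2.2 := ⟨_, fun _ => rfl⟩
  have hmem : ∀ i, (e i).1 ∈ Δ := fun i => (e i).2
  have hwt' : ∀ i t, (I i t : ℕ) + J i t + K i t = 2 := fun i t => by
    rw [hI, hJ, hK]; exact hwt _ (hmem i) t
  have hpat' : ∀ i, (univ.filter fun t => I i t = 1 ∧ J i t = 1).card = a ∧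
      (univ.filter fun t => I i t = 0 ∧ J i t = 1).card = a ∧
      (univ.filter fun t => I i t = 1 ∧ J i t = 0).card = a := fun i => by
    rw [hI, hJ]; exact hpat _ (hmem i)
  have htypI : ∀ i, letterCount (I i) 0 = a + 2 * b ∧ letterCount (I i) 1 = 2 * a ∧
      letterCount (I i) 2 = b := fun i => by rw [hI]; exact (htyp _ (hmem i)).1
  have htypJ : ∀ i, letterCount (J i) 0 = a + 2 * b ∧ letterCount (J i) 1 = 2 * a ∧
      letterCount (J i) 2 = b := fun i => by rw [hJ]; exact (htyp _ (hmem i)).2.1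
  have htypK : ∀ i, letterCount (K i) 0 = a + 2 * b ∧ letterCount (K i) 1 = 2 * a ∧
      letterCount (K i) 2 = b := fun i => by rw [hK]; exact (htyp _ (hmem i)).2.2
  have hfree' : ∀ i j k, (∀ t, (I i t : ℕ) + J j t + K k t = 2) → i = j ∧ j = k := by
    intro i j k h
    have h' := hfree _ (hmem i) _ (hmem j) _ (hmem k) fun t => by
      rw [← hI, ← hJ, ← hK]; exact h t
    exact ⟨e.injective (Subtype.ext h'.1), e.injective (Subtype.ext h'.2)⟩
  -- `N = 3a + 3b` (as soon as a block exists) and the total weight `2N`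
  have hN : ∀ i : Fin Δ.card, N = 3 * a + 3 * b := fun i => by
    have h := sum_letterCount (I i)
    rw [Fin.sum_univ_three] at h
    obtain ⟨h0, h1, h2⟩ := htypI i
    omega
  have hW : ∀ i j k, ∑ t, ((I i t : ℕ) + J j t + K k t) = 2 * N := by
    intro i j k
    rw [sum_add_distrib, sum_add_distrib, slicedSTPP_sum_val, slicedSTPP_sum_val,
      slicedSTPP_sum_val, (htypI i).2.1, (htypI i).2.2, (htypJ j).2.1, (htypJ j).2.2,
      (htypK k).2.1, (htypK k).2.2]
    have := hN i
    omega
  /- 2. the pattern classes `P₁ = {I=0,J=1}`, `P₂ = {I=1,J=0}`, `P₃ = {I=1,J=1}`, enumerated -/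
  have hv0 : ∀ v : Fin 3, v = 0 ↔ (v : ℕ) = 0 := fun v => Fin.ext_iff
  have hv1 : ∀ v : Fin 3, v = 1 ↔ (v : ℕ) = 1 := fun v => Fin.ext_iff
  have hv2 : ∀ v : Fin 3, v = 2 ↔ (v : ℕ) = 2 := fun v => Fin.ext_iff
  have hcls : ∀ P : Finset (Fin N), P.card = a →
      ∃ f : Fin a → Fin N, Function.Injective f ∧ (∀ r, f r ∈ P) ∧ ∀ t ∈ P, ∃ r, f r = t := by
    intro P hP
    refine ⟨P.orderEmbOfFin hP, (P.orderEmbOfFin hP).injective, fun r => P.orderEmbOfFin_mem hP r,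
      fun t ht => ?_⟩
    have : t ∈ Set.range (P.orderEmbOfFin hP) := by rw [range_orderEmbOfFin]; exact ht
    exact this
  choose f₁ hf₁inj hf₁mem hf₁sur using fun i => hcls _ (hpat' i).2.1
  choose f₂ hf₂inj hf₂mem hf₂sur using fun i => hcls _ (hpat' i).2.2
  choose f₃ hf₃inj hf₃mem hf₃sur using fun i => hcls _ (hpat' i).1
  have hf₁pat : ∀ i r, (I i (f₁ i r) : ℕ) = 0 ∧ (J i (f₁ i r) : ℕ) = 1 := fun i r => by
    have h := (mem_filter.1 (hf₁mem i r)).2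
    exact ⟨(hv0 _).1 h.1, (hv1 _).1 h.2⟩
  have hf₂pat : ∀ i r, (I i (f₂ i r) : ℕ) = 1 ∧ (J i (f₂ i r) : ℕ) = 0 := fun i r => by
    have h := (mem_filter.1 (hf₂mem i r)).2
    exact ⟨(hv1 _).1 h.1, (hv0 _).1 h.2⟩
  have hf₃pat : ∀ i r, (I i (f₃ i r) : ℕ) = 1 ∧ (J i (f₃ i r) : ℕ) = 1 := fun i r => by
    have h := (mem_filter.1 (hf₃mem i r)).2
    exact ⟨(hv1 _).1 h.1, (hv1 _).1 h.2⟩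
  have hf₁sur' : ∀ i t, (I i t : ℕ) = 0 → (J i t : ℕ) = 1 → ∃ r, f₁ i r = t :=
    fun i t h0 h1 => hf₁sur i t (mem_filter.2 ⟨mem_univ _, (hv0 _).2 h0, (hv1 _).2 h1⟩)
  have hf₂sur' : ∀ i t, (I i t : ℕ) = 1 → (J i t : ℕ) = 0 → ∃ r, f₂ i r = t :=
    fun i t h0 h1 => hf₂sur i t (mem_filter.2 ⟨mem_univ _, (hv1 _).2 h0, (hv0 _).2 h1⟩)
  have hf₃sur' : ∀ i t, (I i t : ℕ) = 1 → (J i t : ℕ) = 1 → ∃ r, f₃ i r = t :=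
    fun i t h0 h1 => hf₃sur i t (mem_filter.2 ⟨mem_univ _, (hv1 _).2 h0, (hv1 _).2 h1⟩)
  have hf₁off : ∀ i t, ¬((I i t : ℕ) = 0 ∧ (J i t : ℕ) = 1) → ∀ r, f₁ i r ≠ t := by
    rintro i t h r rfl; exact h (hf₁pat i r)
  have hf₂off : ∀ i t, ¬((I i t : ℕ) = 1 ∧ (J i t : ℕ) = 0) → ∀ r, f₂ i r ≠ t := by
    rintro i t h r rfl; exact h (hf₂pat i r)
  have hf₃off : ∀ i t, ¬((I i t : ℕ) = 1 ∧ (J i t : ℕ) = 1) → ∀ r, f₃ i r ≠ t := by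
    rintro i t h r rfl; exact h (hf₃pat i r)
  have hpat6 : ∀ i t, ((I i t : ℕ) = 0 ∧ (J i t : ℕ) = 1) ∨ ((I i t : ℕ) = 1 ∧ (J i t : ℕ) = 0) ∨
      ((I i t : ℕ) = 1 ∧ (J i t : ℕ) = 1) ∨ ((I i t : ℕ) = 0 ∧ (J i t : ℕ) = 0) ∨
      ((I i t : ℕ) = 0 ∧ (J i t : ℕ) = 2) ∨ ((I i t : ℕ) = 2 ∧ (J i t : ℕ) = 0) := fun i t => by
    have h := hwt' i t; have := (I i t).isLt; have := (J i t).isLt; omega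
  /- 3. the vectors: `Av_i κ = (q+1)·1_{I=2} + (κ+1) on P₂`, `Bv_i μ = (μ+1) on P₃`,
    `Cv_i ν = (q+1)·1_{J=2 ∨ (I,J)=(1,1)} + (ν+1) on P₁` -/
  obtain ⟨Av, hAv⟩ : ∃ Av : Fin Δ.card → (Fin a → Fin q) → Fin N → ℕ, ∀ i κ t,
      Av i κ t = (q + 1) * (if (I i t : ℕ) = 2 then 1 else 0) +
        ∑ r, if f₂ i r = t then (κ r : ℕ) + 1 else 0 := ⟨_, fun _ _ _ => rfl⟩
  obtain ⟨Bv, hBv⟩ : ∃ Bv : Fin Δ.card → (Fin a → Fin q) → Fin N → ℕ, ∀ i μ t,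
      Bv i μ t = ∑ r, if f₃ i r = t then (μ r : ℕ) + 1 else 0 := ⟨_, fun _ _ _ => rfl⟩
  obtain ⟨Cv, hCv⟩ : ∃ Cv : Fin Δ.card → (Fin a → Fin q) → Fin N → ℕ, ∀ i ν t,
      Cv i ν t = (q + 1) * (if (J i t : ℕ) = 2 ∨ ((I i t : ℕ) = 1 ∧ (J i t : ℕ) = 1) then 1 else 0) +
        ∑ r, if f₁ i r = t then (ν r : ℕ) + 1 else 0 := ⟨_, fun _ _ _ => rfl⟩
  -- value tables
  have hAv_f2 : ∀ i κ r, Av i κ (f₂ i r) = κ r + 1 := fun i κ r => by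
    have hp := hf₂pat i r
    rw [hAv, if_neg (by omega), slicedSTPP_graft_at _ (hf₂inj i)]
    ring
  have hAv_two : ∀ i κ t, (I i t : ℕ) = 2 → Av i κ t = q + 1 := fun i κ t h => by
    rw [hAv, if_pos h, slicedSTPP_graft_off _ _ _ (hf₂off i t (by omega))]
    ring
  have hAv_zero : ∀ i κ t, (I i t : ℕ) ≠ 2 → ¬((I i t : ℕ) = 1 ∧ (J i t : ℕ) = 0) →
      Av i κ t = 0 := fun i κ t h2 h10 => by
    rw [hAv, if_neg h2, slicedSTPP_graft_off _ _ _ (hf₂off i t h10), mul_zero, add_zero]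
  have hBv_f3 : ∀ i μ r, Bv i μ (f₃ i r) = μ r + 1 := fun i μ r => by
    rw [hBv, slicedSTPP_graft_at _ (hf₃inj i)]
  have hBv_zero : ∀ i μ t, ¬((I i t : ℕ) = 1 ∧ (J i t : ℕ) = 1) → Bv i μ t = 0 :=
    fun i μ t h => by rw [hBv, slicedSTPP_graft_off _ _ _ (hf₃off i t h)]
  have hCv_f1 : ∀ i ν r, Cv i ν (f₁ i r) = ν r + 1 := fun i ν r => by
    have hp := hf₁pat i r
    rw [hCv, if_neg (by omega), slicedSTPP_graft_at _ (hf₁inj i)]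
    ring
  have hCv_big : ∀ i ν t, ((J i t : ℕ) = 2 ∨ ((I i t : ℕ) = 1 ∧ (J i t : ℕ) = 1)) →
      Cv i ν t = q + 1 := fun i ν t h => by
    rw [hCv, if_pos h, slicedSTPP_graft_off _ _ _ (hf₁off i t (by omega))]
    ring
  have hCv_zero : ∀ i ν t, (J i t : ℕ) ≠ 2 → ¬((I i t : ℕ) = 1 ∧ (J i t : ℕ) = 1) →
      ¬((I i t : ℕ) = 0 ∧ (J i t : ℕ) = 1) → Cv i ν t = 0 := fun i ν t h2 h11 h01 => by
    rw [hCv, if_neg (by omega), slicedSTPP_graft_off _ _ _ (hf₁off i t h01), mul_zero, add_zero]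
  /- 4. level tables of `X = Av_i + Bv_i`, `Y = Cv_j - Bv_j`, `Z = Av_k + Cv_k` -/
  have hX : ∀ i κ μ t, ((I i t : ℕ) = 0 ∧ Av i κ t + Bv i μ t = 0) ∨
      ((I i t : ℕ) = 1 ∧ 1 ≤ Av i κ t + Bv i μ t ∧ Av i κ t + Bv i μ t ≤ q) ∨
      ((I i t : ℕ) = 2 ∧ Av i κ t + Bv i μ t = q + 1) := by
    intro i κ μ t
    rcases hpat6 i t with h | h | h | h | h | h
    · rw [hAv_zero i κ t (by omega) (by omega), hBv_zero i μ t (by omega)]; omega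
    · obtain ⟨r, rfl⟩ := hf₂sur' i t h.1 h.2
      rw [hAv_f2, hBv_zero i μ _ (by omega)]; have := (κ r).isLt; omega
    · obtain ⟨r, rfl⟩ := hf₃sur' i t h.1 h.2
      rw [hAv_zero i κ _ (by omega) (by omega), hBv_f3]; have := (μ r).isLt; omega
    · rw [hAv_zero i κ t (by omega) (by omega), hBv_zero i μ t (by omega)]; omega
    · rw [hAv_zero i κ t (by omega) (by omega), hBv_zero i μ t (by omega)]; omega
    · rw [hAv_two i κ t h.1, hBv_zero i μ t (by omega)]; omega
  have hBC : ∀ j μ ν t, Bv j μ t ≤ Cv j ν t := by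
    intro j μ ν t
    by_cases h : (I j t : ℕ) = 1 ∧ (J j t : ℕ) = 1
    · obtain ⟨r, rfl⟩ := hf₃sur' j t h.1 h.2
      rw [hBv_f3, hCv_big j ν _ (Or.inr h)]; have := (μ r).isLt; omega
    · rw [hBv_zero j μ t h]; exact Nat.zero_le _
  have hY : ∀ j μ ν t, ((J j t : ℕ) = 0 ∧ Cv j ν t - Bv j μ t = 0) ∨
      ((J j t : ℕ) = 1 ∧ 1 ≤ Cv j ν t - Bv j μ t ∧ Cv j ν t - Bv j μ t ≤ q) ∨
      ((J j t : ℕ) = 2 ∧ Cv j ν t - Bv j μ t = q + 1) := by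
    intro j μ ν t
    rcases hpat6 j t with h | h | h | h | h | h
    · obtain ⟨r, rfl⟩ := hf₁sur' j t h.1 h.2
      rw [hCv_f1, hBv_zero j μ _ (by omega)]; have := (ν r).isLt; omega
    · rw [hCv_zero j ν t (by omega) (by omega) (by omega), hBv_zero j μ t (by omega)]; omega
    · obtain ⟨r, rfl⟩ := hf₃sur' j t h.1 h.2
      rw [hCv_big j ν _ (Or.inr h), hBv_f3]; have := (μ r).isLt; omega
    · rw [hCv_zero j ν t (by omega) (by omega) (by omega), hBv_zero j μ t (by omega)]; omega
    · rw [hCv_big j ν t (Or.inl h.2), hBv_zero j μ t (by omega)]; omega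
    · rw [hCv_zero j ν t (by omega) (by omega) (by omega), hBv_zero j μ t (by omega)]; omega
  have hZ : ∀ k κ ν t, ((K k t : ℕ) = 0 ∧ Av k κ t + Cv k ν t = q + 1) ∨
      ((K k t : ℕ) = 1 ∧ 1 ≤ Av k κ t + Cv k ν t ∧ Av k κ t + Cv k ν t ≤ q) ∨
      ((K k t : ℕ) = 2 ∧ Av k κ t + Cv k ν t = 0) := by
    intro k κ ν t
    have hk := hwt' k t
    rcases hpat6 k t with h | h | h | h | h | h
    · obtain ⟨r, rfl⟩ := hf₁sur' k t h.1 h.2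
      rw [hAv_zero k κ _ (by omega) (by omega), hCv_f1]; have := (ν r).isLt; omega
    · obtain ⟨r, rfl⟩ := hf₂sur' k t h.1 h.2
      rw [hAv_f2, hCv_zero k ν _ (by omega) (by omega) (by omega)]; have := (κ r).isLt; omega
    · rw [hAv_zero k κ t (by omega) (by omega), hCv_big k ν t (Or.inr h)]; omega
    · rw [hAv_zero k κ t (by omega) (by omega), hCv_zero k ν t (by omega) (by omega) (by omega)]
      omega
    · rw [hAv_zero k κ t (by omega) (by omega), hCv_big k ν t (Or.inl h.2)]; omega
    · rw [hAv_two k κ t h.1, hCv_zero k ν t (by omega) (by omega) (by omega)]; omega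
  /- 5. constant digit sums on the slice -/
  have hcntI2 : ∀ i, (univ.filter fun t => (I i t : ℕ) = 2).card = b := fun i => by
    rw [← (htypI i).2.2, letterCount_apply]
    exact congrArg card (filter_congr fun t _ => (hv2 _).symm)
  have hcntC : ∀ i, (univ.filter fun t => (J i t : ℕ) = 2 ∨ ((I i t : ℕ) = 1 ∧ (J i t : ℕ) = 1)).card =
      b + a := fun i => by
    rw [filter_or, card_union_of_disjoint (disjoint_filter.2 fun t _ h h' => by omega),
      ← (htypJ i).2.2, letterCount_apply, ← (hpat' i).1]
    congr 1
    · exact congrArg card (filter_congr fun t _ => (hv2 _).symm)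
    · exact congrArg card (filter_congr fun t _ => by rw [hv1, hv1])
  have hSA : ∀ i, ∀ κ ∈ Sl, ∑ t, Av i κ t = (q + 1) * b + (σ + a) := by
    intro i κ hκ
    simp_rw [hAv]
    rw [sum_add_distrib, ← mul_sum, sum_boole, Nat.cast_id, hcntI2, slicedSTPP_graft_sum,
      sum_add_distrib, sum_const, card_univ, Fintype.card_fin, smul_eq_mul, mul_one, hSl κ hκ]
  have hSB : ∀ i, ∀ μ ∈ Sl, ∑ t, Bv i μ t = σ + a := by
    intro i μ hμ
    simp_rw [hBv]
    rw [slicedSTPP_graft_sum, sum_add_distrib, sum_const, card_univ, Fintype.card_fin, smul_eq_mul,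
      mul_one, hSl μ hμ]
  have hSC : ∀ i, ∀ ν ∈ Sl, ∑ t, Cv i ν t = (q + 1) * (b + a) + (σ + a) := by
    intro i ν hν
    simp_rw [hCv]
    rw [sum_add_distrib, ← mul_sum, sum_boole, Nat.cast_id, hcntC, slicedSTPP_graft_sum,
      sum_add_distrib, sum_const, card_univ, Fintype.card_fin, smul_eq_mul, mul_one, hSl ν hν]
  /- 6. the shared digits are read off on the classes -/
  have hread : ∀ i κ κ' μ μ' ν ν',
      (∀ t, (Av i κ' t + Bv i μ t) + (Cv i ν t - Bv i μ' t) = Av i κ t + Cv i ν' t) →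
        κ' = κ ∧ μ = μ' ∧ ν = ν' := by
    intro i κ κ' μ μ' ν ν' h
    refine ⟨funext fun r => Fin.ext ?_, funext fun r => Fin.ext ?_, funext fun r => Fin.ext ?_⟩
    · have ht := h (f₂ i r)
      have hp := hf₂pat i r
      rw [hAv_f2, hAv_f2, hBv_zero i μ _ (by omega), hBv_zero i μ' _ (by omega),
        hCv_zero i ν _ (by omega) (by omega) (by omega),
        hCv_zero i ν' _ (by omega) (by omega) (by omega)] at ht
      omega
    · have ht := h (f₃ i r)
      have hp := hf₃pat i r
      rw [hAv_zero i κ' _ (by omega) (by omega), hAv_zero i κ _ (by omega) (by omega), hBv_f3,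
        hBv_f3, hCv_big i ν _ (Or.inr hp), hCv_big i ν' _ (Or.inr hp)] at ht
      have := (μ' r).isLt
      omega
    · have ht := h (f₁ i r)
      have hp := hf₁pat i r
      rw [hAv_zero i κ' _ (by omega) (by omega), hAv_zero i κ _ (by omega) (by omega),
        hBv_zero i μ _ (by omega), hBv_zero i μ' _ (by omega), hCv_f1, hCv_f1] at ht
      omega
  have hAinj : ∀ i, Function.Injective (Av i) := fun i κ₁ κ₂ h => funext fun r => Fin.ext (by
    have h' := congrFun h (f₂ i r); rw [hAv_f2, hAv_f2] at h'; omega)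
  have hBinj : ∀ i, Function.Injective (Bv i) := fun i μ₁ μ₂ h => funext fun r => Fin.ext (by
    have h' := congrFun h (f₃ i r); rw [hBv_f3, hBv_f3] at h'; omega)
  have hCinj : ∀ i, Function.Injective (Cv i) := fun i ν₁ ν₂ h => funext fun r => Fin.ext (by
    have h' := congrFun h (f₁ i r); rw [hCv_f1, hCv_f1] at h'; omega)
  /- 7. the valuation `v ↦ ∑ v_t ℓ^t` of `ℕ`-digit vectors in `ℤ/ℓ^N` -/
  obtain ⟨nval, hnval⟩ : ∃ nval : (Fin N → ℕ) → ZMod (ℓ ^ N), ∀ v,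
      nval v = ∑ t, ((v t : ℕ) : ZMod (ℓ ^ N)) * (ℓ : ZMod (ℓ ^ N)) ^ (t : ℕ) := ⟨_, fun _ => rfl⟩
  have hadd : ∀ v w : Fin N → ℕ, nval (fun t => v t + w t) = nval v + nval w := fun v w => by
    rw [hnval, hnval, hnval, ← sum_add_distrib]
    exact sum_congr rfl fun t _ => by push_cast; ring
  have hsub : ∀ v w : Fin N → ℕ, (∀ t, w t ≤ v t) → nval (fun t => v t - w t) = nval v - nval w :=
    fun v w h => by
    rw [hnval, hnval, hnval, ← sum_sub_distrib]
    exact sum_congr rfl fun t _ => by rw [Nat.cast_sub (h t)]; ring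
  have hnval_digit : ∀ (v : Fin N → ℕ) (hv : ∀ t, v t < ℓ),
      nval v = (digitValue (fun t => (⟨v t, hv t⟩ : Fin ℓ)) : ZMod (ℓ ^ N)) := fun v hv => by
    rw [hnval]
    unfold digitValue
    push_cast
    rfl
  have hninj : ∀ v w : Fin N → ℕ, (∀ t, v t < ℓ) → (∀ t, w t < ℓ) → nval v = nval w → v = w := by
    intro v w hv hw h
    rw [hnval_digit v hv, hnval_digit w hw] at h
    funext t
    exact congrArg Fin.val (congrFun (natCast_digitValue_injective ℓ N h) t)
  have hdigN : ∀ X Y Z : Fin N → ℕ, (∀ t, X t < ℓ) → (∀ t, Y t < ℓ) → (∀ t, Z t < ℓ) →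
      nval X + nval Y = nval Z → ∑ t, X t + ∑ t, Y t = ∑ t, Z t → ∀ t, X t + Y t = Z t := by
    intro X Y Z hXl hYl hZl hrel hsum t
    rw [hnval_digit X hXl, hnval_digit Y hYl, hnval_digit Z hZl] at hrel
    exact hdig _ _ _ hrel hsum t
  /- 8. the kernel -/
  exact ⟨_, _, _, slicedSTPP_kernel hℓ I J K hfree' hW nval hadd hsub hninj hdigN Av Bv Cv hX hBC
    hY hZ Sl _ _ _ hSA hSB hSC hread hAinj hBinj hCinj⟩

end AutomaticDesignBelowFourFifths

end Summit.MatrixMultiplication.MatrixMultiplication.Theorems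

end
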